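import Literature.Geometry.Riemannian.OneFormChartBounds
import Literature.Geometry.Riemannian.L2HarmonicOneFormsSobolev
import Literature.Geometry.Lorentzian.VolumeChartIntegral
import Literature.Analysis.FunctionSpaces.SobolevDomainProofs
import Mathlib.Analysis.Calculus.BumpFunction.FiniteDimension
import Mathlib.Analysis.InnerProductSpace.Calculus
import HarnessLib

/-!
# Rellich compactness for `1`-forms on a coordinate patch

Compactness step (chart-local part) of the proof programme of the named fact
`Literature.Geometry.Riemannian.Carron1999_finrank_l2HarmonicOneForms_le` (Carron's memoir,
Thm. 4.3: under a Sobolev inequality and `Ric ∈ L^{p/2}` the space `ℋ¹` of `L²` harmonic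
`1`-forms is finite dimensional). Carron's printed proof obtains finiteness from the compactness
of the operator `T = Δ̄^{-1/2} R₁ Δ̄^{-1/2}`, "limite en norme des opérateurs compacts
`Δ̄^{-1/2} 1_{B_R} R₁ 1_{B_R} Δ̄^{-1/2}`" (memoir, p. 23) — a Rellich-type compactness on bounded
sets. In the pointwise language of this tree the same compactness is the classical
**Rellich–Kondrachov theorem applied chartwise to the coefficient functions of the forms**: if a
sequence of smooth `1`-forms `αₙ` has `∫_U (|αₙ|² + |∇αₙ|²) dV_h` bounded on a coordinate ball
`U`, then along a subsequence the `αₙ` form a Cauchy sequence in `L²` of a smaller coordinate ball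
(Evans, *PDE*, §5.7, Thm. 1; here through the tree's `C¹` core
`Literature.Analysis.FunctionSpaces.exists_subseq_tendsto_eLpNorm_of_contDiff`).

For a smooth Riemannian metric `h` on a manifold `N` modelled on `ℝ^m` (boundaryless model),
this file PROVES

* `opNorm_le_sum_euclidean` — `‖L‖ ≤ ∑ₖ ‖L eₖ‖` for a continuous linear map on `ℝ^m`;
* `contDiff_smul_of_tsupport_subset` — a smooth function on an open set times a smooth cut-off
  supported inside it is smooth on the whole space;
* `exists_density_bounds` — on a compact subset of a chart target the Riemannian density
  `√(det h_{ij})` is pinched between two positive constants;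
* `exists_subseq_cauchy_oneForm_chart` — **the chart-local Rellich lemma for `1`-forms**: for
  smooth `1`-forms `αₙ` with `∫_{φ⁻¹ B̄(φ x₀, 2r)} (|αₙ|²_h + |∇αₙ|²_h) dV_h ≤ A`, some subsequence
  satisfies `∫_{φ⁻¹ B(φ x₀, r)} |α_{ψ a} - α_{ψ b}|²_h dV_h → 0` as `a, b → ∞`.

Everything is proved; no definitions, no named facts (D-0026).

## References

* L. C. Evans, *Partial Differential Equations*, 2nd ed., AMS 2010, §5.7, Thm. 1
  (Rellich–Kondrachov). [`Evans2010`]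
* G. Carron, *Formes harmoniques L² sur les variétés riemanniennes non-compactes*, mémoire
  d'habilitation (1999) = Rend. Mat. Appl. (7) 21 (2001), §4.b, proof of Thm. 4.3 (p. 23).
  [`Carron1999HdR`]
-/

noncomputable section

open Bundle Set Function Filter FiberBundle Metric
open scoped Manifold ContDiff Topology ENNReal NNReal

namespace Literature.Geometry.Riemannian

open _root_.MeasureTheory Literature.Geometry.Lorentzian

/-! ### Two elementary analytic lemmas -/

section Elementary

variable {m : ℕ} {F : Type*} [NormedAddCommGroup F] [NormedSpace ℝ F]

/-- `‖L‖ ≤ ∑ₖ ‖L eₖ‖` for a continuous linear map on `ℝ^m` and the standard basis `eₖ`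
(`x = ∑ xₖ eₖ` with `|xₖ| ≤ ‖x‖`). [folklore] -/
theorem opNorm_le_sum_euclidean (L : EuclideanSpace ℝ (Fin m) →L[ℝ] F) :
    ‖L‖ ≤ ∑ k, ‖L (EuclideanSpace.single k (1 : ℝ))‖ := by
  refine ContinuousLinearMap.opNorm_le_bound _ (Finset.sum_nonneg fun _ _ ↦ norm_nonneg _)
    fun x ↦ ?_
  have hx : x = ∑ k, x k • EuclideanSpace.single k (1 : ℝ) := by
    conv_lhs => rw [← (EuclideanSpace.basisFun (Fin m) ℝ).sum_repr x]
    simp [EuclideanSpace.basisFun_apply]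
  calc ‖L x‖ = ‖∑ k, x k • L (EuclideanSpace.single k (1 : ℝ))‖ := by
        conv_lhs => rw [hx]
        simp only [map_sum, map_smul]
    _ ≤ ∑ k, ‖x k • L (EuclideanSpace.single k (1 : ℝ))‖ := norm_sum_le _ _
    _ ≤ ∑ k, ‖L (EuclideanSpace.single k (1 : ℝ))‖ * ‖x‖ := by
        refine Finset.sum_le_sum fun k _ ↦ ?_
        rw [norm_smul, mul_comm]
        exact mul_le_mul_of_nonneg_left (by simpa using PiLp.norm_apply_le x k) (norm_nonneg _)
    _ = (∑ k, ‖L (EuclideanSpace.single k (1 : ℝ))‖) * ‖x‖ := (Finset.sum_mul _ _ _).symm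

variable {E : Type*} [NormedAddCommGroup E] [NormedSpace ℝ E]

/-- **Globalising by a cut-off**: if `f` is `C^n` on an open set `T` and `χ` is `C^n` with
`tsupport χ ⊆ T`, then `χ • f` is `C^n` on the whole space (it vanishes on a neighbourhood of every
point outside `T`). [folklore] -/
theorem contDiff_smul_of_tsupport_subset {n : ℕ∞ω} {T : Set E} (hT : IsOpen T) {f : E → F}
    (hf : ContDiffOn ℝ n f T) {χ : E → ℝ} (hχ : ContDiff ℝ n χ) (hχT : tsupport χ ⊆ T) :
    ContDiff ℝ n fun z ↦ χ z • f z := by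
  refine contDiff_iff_contDiffAt.2 fun z ↦ ?_
  by_cases hz : z ∈ T
  · exact hχ.contDiffAt.smul (hf.contDiffAt (hT.mem_nhds hz))
  · have hz' : z ∉ tsupport χ := fun h ↦ hz (hχT h)
    have hev : (fun z ↦ χ z • f z) =ᶠ[𝓝 z] fun _ ↦ 0 := by
      filter_upwards [(isClosed_tsupport χ).isOpen_compl.mem_nhds hz'] with y hy
      rw [image_eq_zero_of_notMem_tsupport hy, zero_smul]
    exact (contDiffAt_const (c := (0 : F))).congr_of_eventuallyEq hev

end Elementary

/-! ### The Riemannian density on a compact part of a chart target -/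

section Density

variable {m : ℕ} {H' : Type*} [TopologicalSpace H']
  {J : ModelWithCorners ℝ (EuclideanSpace ℝ (Fin m)) H'}
  {N : Type*} [TopologicalSpace N] [ChartedSpace H' N] [IsManifold J ∞ N]
  (h : ContMDiffRiemannianMetric J ∞ (EuclideanSpace ℝ (Fin m)) (TangentSpace J : N → Type _))

/-- **The Riemannian density is pinched on compact parts of the chart target**: for a compact
`C ⊆ (extChartAt J x₀).target` there are `0 < δ ≤ Δ` with `δ ≤ √(det h_{ij}(y)) ≤ Δ` on `C`
(continuity and positivity of the density, `continuousOn_sqrt_det_chartGramMatrix`,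
`sqrt_det_chartGramMatrix_pos`). [folklore] -/
theorem exists_density_bounds (x₀ : N) {C : Set (EuclideanSpace ℝ (Fin m))} (hC : IsCompact C)
    (hCt : C ⊆ (extChartAt J x₀).target) :
    ∃ δ Δ : ℝ, 0 < δ ∧ δ ≤ Δ ∧ ∀ y ∈ C, δ ≤ Real.sqrt (chartGramMatrix h x₀ y).det ∧
      Real.sqrt (chartGramMatrix h x₀ y).det ≤ Δ := by
  haveI : IsManifold J 1 N := IsManifold.of_le (n := ∞) (by exact_mod_cast le_top)
  have hcont : ContinuousOn (fun y ↦ Real.sqrt (chartGramMatrix h x₀ y).det) C :=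
    (continuousOn_sqrt_det_chartGramMatrix h x₀).mono hCt
  rcases C.eq_empty_or_nonempty with hCe | hCne
  · exact ⟨1, 1, one_pos, le_rfl, fun y hy ↦ by simp [hCe] at hy⟩
  obtain ⟨y₁, hy₁, hmin⟩ := hC.exists_isMinOn hCne hcont
  obtain ⟨y₂, hy₂, hmax⟩ := hC.exists_isMaxOn hCne hcont
  refine ⟨Real.sqrt (chartGramMatrix h x₀ y₁).det, Real.sqrt (chartGramMatrix h x₀ y₂).det,
    sqrt_det_chartGramMatrix_pos h x₀ (hCt hy₁), hmin hy₂, fun y hy ↦ ⟨hmin hy, hmax hy⟩⟩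

end Density

/-! ### Coefficient functions of `1`-forms in a chart -/

section Chart

variable {m : ℕ} {H' : Type*} [TopologicalSpace H']
  {J : ModelWithCorners ℝ (EuclideanSpace ℝ (Fin m)) H'}
  {N : Type*} [TopologicalSpace N] [ChartedSpace H' N] [IsManifold J ∞ N]

/-- **The coefficient functions of a smooth `1`-form are smooth on the chart target**:
`z ↦ α(∂ᵢ)(φ⁻¹ z)` is `C^∞` on `(extChartAt J x₀).target` (`contMDiffAt_oneForm_apply_localFrame`
composed with the smooth inverse chart). [folklore] -/
theorem contDiffOn_oneForm_coeff (x₀ : N) {α : Π x : N, TangentSpace J x →L[ℝ] ℝ}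
    (hα : ∀ x, ContMDiffAt J (J.prod 𝓘(ℝ, EuclideanSpace ℝ (Fin m) →L[ℝ] ℝ)) ∞ (oneFormSection α) x)
    (i : Fin m) :
    ContDiffOn ℝ ∞ ((fun q ↦ α q ((trivializationAt (EuclideanSpace ℝ (Fin m)) (TangentSpace J) x₀).localFrame
        (EuclideanSpace.basisFun (Fin m) ℝ).toBasis i q)) ∘ (extChartAt J x₀).symm)
      (extChartAt J x₀).target := by
  rw [← contMDiffOn_iff_contDiffOn]
  have hin : ContMDiffOn J 𝓘(ℝ, ℝ) ∞ (fun q ↦ α q ((trivializationAt (EuclideanSpace ℝ (Fin m))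
      (TangentSpace J) x₀).localFrame (EuclideanSpace.basisFun (Fin m) ℝ).toBasis i q))
      (chartAt H' x₀).source := fun q hq ↦
    (contMDiffAt_oneForm_apply_localFrame (EuclideanSpace.basisFun (Fin m) ℝ).toBasis hq (hα q) i)
      |>.contMDiffWithinAt
  refine ContMDiffOn.comp hin (contMDiffOn_extChartAt_symm x₀) fun z hz ↦ ?_
  show (extChartAt J x₀).symm z ∈ (chartAt H' x₀).source
  rw [← extChartAt_source J]
  exact (extChartAt J x₀).map_target hz

/-- The vector of coefficient functions `z ↦ (α(∂₁)(φ⁻¹ z), …, α(∂ₘ)(φ⁻¹ z))` is smooth on the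
chart target. [folklore] -/
theorem contDiffOn_oneForm_coeffVec (x₀ : N) {α : Π x : N, TangentSpace J x →L[ℝ] ℝ}
    (hα : ∀ x, ContMDiffAt J (J.prod 𝓘(ℝ, EuclideanSpace ℝ (Fin m) →L[ℝ] ℝ)) ∞ (oneFormSection α) x) :
    ContDiffOn ℝ ∞ (fun z (i : Fin m) ↦ α ((extChartAt J x₀).symm z)
        ((trivializationAt (EuclideanSpace ℝ (Fin m)) (TangentSpace J) x₀).localFrame
          (EuclideanSpace.basisFun (Fin m) ℝ).toBasis i ((extChartAt J x₀).symm z)))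
      (extChartAt J x₀).target :=
  contDiffOn_pi.2 fun i ↦ contDiffOn_oneForm_coeff x₀ hα i

end Chart

/-! ### Integrals over chart pieces: `dV_h = √(det h_{ij}) dz` with the density pinched -/

section Transfer

variable {m : ℕ} {H' : Type*} [TopologicalSpace H']
  {J : ModelWithCorners ℝ (EuclideanSpace ℝ (Fin m)) H'}
  {N : Type*} [TopologicalSpace N] [ChartedSpace H' N] [IsManifold J ∞ N]
  [T3Space N] [MeasurableSpace N] [BorelSpace N]
  (h : ContMDiffRiemannianMetric J ∞ (EuclideanSpace ℝ (Fin m)) (TangentSpace J : N → Type _))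

/-- **Change of variables on a chart piece**: for measurable `B ⊆ (extChartAt J x₀).target` and
measurable `F : N → [0, ∞]`,
`∫_{φ.source ∩ φ⁻¹ B} F dV_h = ∫_B F(φ⁻¹ z) √(det h_{ij}(z)) dz` (`lintegral_eq_lintegral_chart`
applied to `1_{φ.source ∩ φ⁻¹ B} F`). Chavel 2006, §III.3, (III.3.6). [folklore] -/
theorem setLIntegral_chart_piece (x₀ : N) {B : Set (EuclideanSpace ℝ (Fin m))}
    (hBm : MeasurableSet B) (hBt : B ⊆ (extChartAt J x₀).target) {F : N → ℝ≥0∞}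
    (hF : Measurable F) :
    ∫⁻ y in (extChartAt J x₀).source ∩ extChartAt J x₀ ⁻¹' B, F y ∂riemannianMeasure h =
      ∫⁻ z in B, F ((extChartAt J x₀).symm z) *
        ENNReal.ofReal (Real.sqrt (chartGramMatrix h x₀ z).det) := by
  haveI : IsManifold J 1 N := IsManifold.of_le (n := ∞) (by exact_mod_cast le_top)
  set S : Set N := (extChartAt J x₀).source ∩ extChartAt J x₀ ⁻¹' B with hS
  have hSm : MeasurableSet S := measurableSet_source_inter_preimage_extChartAt x₀ hBm
  have h1 : ∫⁻ y in S, F y ∂riemannianMeasure h = ∫⁻ y, S.indicator F y ∂riemannianMeasure h :=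
    (lintegral_indicator hSm _).symm
  rw [h1, lintegral_eq_lintegral_chart h x₀ (hF.indicator hSm)
    ((support_indicator_subset).trans inter_subset_left),
    ← lintegral_indicator (measurableSet_extChartAt_target x₀), ← lintegral_indicator hBm]
  refine lintegral_congr fun z ↦ ?_
  by_cases hz : z ∈ (extChartAt J x₀).target
  · rw [indicator_of_mem hz]
    by_cases hzB : z ∈ B
    · rw [indicator_of_mem hzB, indicator_of_mem]
      exact ⟨(extChartAt J x₀).map_target hz, by
        rw [mem_preimage, (extChartAt J x₀).right_inv hz]; exact hzB⟩
    · rw [indicator_of_notMem hzB, indicator_of_notMem, zero_mul]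
      rintro ⟨-, h'⟩
      rw [mem_preimage, (extChartAt J x₀).right_inv hz] at h'
      exact hzB h'
  · rw [indicator_of_notMem hz, indicator_of_notMem (fun h' ↦ hz (hBt h'))]

/-- **From the manifold to the chart**: if `√(det h_{ij}) ≥ δ > 0` on a measurable
`B ⊆ φ.target`, then `δ ∫_B F(φ⁻¹ z) dz ≤ ∫_{φ.source ∩ φ⁻¹ B} F dV_h`. [folklore] -/
theorem mul_setLIntegral_chart_le (x₀ : N) {B : Set (EuclideanSpace ℝ (Fin m))}
    (hBm : MeasurableSet B) (hBt : B ⊆ (extChartAt J x₀).target) {δ : ℝ}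
    (hδ : ∀ z ∈ B, δ ≤ Real.sqrt (chartGramMatrix h x₀ z).det) {F : N → ℝ≥0∞} (hF : Measurable F) :
    ENNReal.ofReal δ * ∫⁻ z in B, F ((extChartAt J x₀).symm z) ≤
      ∫⁻ y in (extChartAt J x₀).source ∩ extChartAt J x₀ ⁻¹' B, F y ∂riemannianMeasure h := by
  rw [setLIntegral_chart_piece h x₀ hBm hBt hF, ← lintegral_const_mul' _ _ ENNReal.ofReal_ne_top]
  refine setLIntegral_mono' hBm fun z hz ↦ ?_
  rw [mul_comm]
  exact mul_le_mul' le_rfl (ENNReal.ofReal_le_ofReal (hδ z hz))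

/-- **From the chart to the manifold**: if `√(det h_{ij}) ≤ Δ` on a measurable `B ⊆ φ.target`,
then `∫_{φ.source ∩ φ⁻¹ B} F dV_h ≤ Δ ∫_B F(φ⁻¹ z) dz`. [folklore] -/
theorem setLIntegral_chart_piece_le_mul (x₀ : N) {B : Set (EuclideanSpace ℝ (Fin m))}
    (hBm : MeasurableSet B) (hBt : B ⊆ (extChartAt J x₀).target) {Δ : ℝ}
    (hΔ : ∀ z ∈ B, Real.sqrt (chartGramMatrix h x₀ z).det ≤ Δ) {F : N → ℝ≥0∞} (hF : Measurable F) :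
    ∫⁻ y in (extChartAt J x₀).source ∩ extChartAt J x₀ ⁻¹' B, F y ∂riemannianMeasure h ≤
      ENNReal.ofReal Δ * ∫⁻ z in B, F ((extChartAt J x₀).symm z) := by
  rw [setLIntegral_chart_piece h x₀ hBm hBt hF, ← lintegral_const_mul' _ _ ENNReal.ofReal_ne_top]
  refine setLIntegral_mono' hBm fun z hz ↦ ?_
  rw [mul_comm]
  exact mul_le_mul' (ENNReal.ofReal_le_ofReal (hΔ z hz)) le_rfl

end Transfer

/-! ### Pointwise bounds for the coefficient vector and its derivative -/

section Pointwise

variable {m : ℕ} {H' : Type*} [TopologicalSpace H']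
  {J : ModelWithCorners ℝ (EuclideanSpace ℝ (Fin m)) H'} [J.Boundaryless]
  {N : Type*} [TopologicalSpace N] [ChartedSpace H' N] [IsManifold J ∞ N]
  (h : ContMDiffRiemannianMetric J ∞ (EuclideanSpace ℝ (Fin m)) (TangentSpace J : N → Type _))
  [(PseudoRiemannianMetric.ofRiemannian h).HasLeviCivita]

omit [J.Boundaryless] [(PseudoRiemannianMetric.ofRiemannian h).HasLeviCivita] in
/-- **The coefficient vector is controlled by `|α|_h`**: with the sup norm on `ℝ^m = (Fin m → ℝ)`,
`‖(α_p(∂ᵢ))ᵢ‖² ≤ (∑ᵢ h(∂ᵢ,∂ᵢ)(p)) h⁻¹(α_p, α_p)` (`sum_sq_oneForm_apply_le`). [folklore] -/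
theorem norm_coeffVec_sq_le (x₀ p : N) (α : Module.Dual ℝ (TangentSpace J p)) :
    ‖fun i : Fin m ↦ α ((trivializationAt (EuclideanSpace ℝ (Fin m)) (TangentSpace J) x₀).localFrame
        (EuclideanSpace.basisFun (Fin m) ℝ).toBasis i p)‖ ^ 2 ≤
      (∑ i, (PseudoRiemannianMetric.ofRiemannian h).val p
        ((trivializationAt (EuclideanSpace ℝ (Fin m)) (TangentSpace J) x₀).localFrame
          (EuclideanSpace.basisFun (Fin m) ℝ).toBasis i p)
        ((trivializationAt (EuclideanSpace ℝ (Fin m)) (TangentSpace J) x₀).localFrame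
          (EuclideanSpace.basisFun (Fin m) ℝ).toBasis i p)) *
        (PseudoRiemannianMetric.ofRiemannian h).innerDual p α α := by
  set G := PseudoRiemannianMetric.ofRiemannian h with hG
  have hg : G.IsRiemannian := PseudoRiemannianMetric.isRiemannian_ofRiemannian h
  set s := fun i : Fin m ↦ (trivializationAt (EuclideanSpace ℝ (Fin m)) (TangentSpace J) x₀).localFrame
    (EuclideanSpace.basisFun (Fin m) ℝ).toBasis i p with hs
  have hsum := sum_sq_oneForm_apply_le G hg p α s
  have h0 : 0 ≤ (∑ i, G.val p (s i) (s i)) * G.innerDual p α α := by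
    refine mul_nonneg (Finset.sum_nonneg fun i _ ↦ ?_) ?_
    · by_cases h0 : s i = 0
      · rw [h0]; simp
      · exact (hg p _ h0).le
    · rw [G.innerDual_eq_val_sharp_sharp]
      by_cases h0 : G.sharp p α = 0
      · rw [h0]; simp
      · exact (hg p _ h0).le
  have hle : ‖fun i : Fin m ↦ α (s i)‖ ≤ Real.sqrt ((∑ i, G.val p (s i) (s i)) * G.innerDual p α α) := by
    refine (pi_norm_le_iff_of_nonneg (Real.sqrt_nonneg _)).2 fun i ↦ ?_
    rw [Real.norm_eq_abs]
    refine Real.abs_le_sqrt ?_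
    exact (Finset.single_le_sum (f := fun j ↦ (α (s j)) ^ 2) (fun _ _ ↦ sq_nonneg _)
      (Finset.mem_univ i)).trans hsum
  calc ‖fun i : Fin m ↦ α (s i)‖ ^ 2
      ≤ (Real.sqrt ((∑ i, G.val p (s i) (s i)) * G.innerDual p α α)) ^ 2 :=
        pow_le_pow_left₀ (norm_nonneg _) hle 2
    _ = _ := Real.sq_sqrt h0

/-- **The derivative of the coefficient vector is controlled by `|∇α|_h` and `|α|_h`.** At a point
`z` of the chart target, `p = φ⁻¹ z`, if `Λ ≥ 1` bounds `∑ᵢ h(∂ᵢ,∂ᵢ)(p)` and all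
`h(∇_{∂ₖ}∂ᵢ, ∇_{∂ₖ}∂ᵢ)(p)`, then for a `1`-form `α` differentiable at `p`
`‖D(α̂₁,…,α̂ₘ)(z)‖ ≤ m (2Λ² (|∇α|²_h(p) + |α|²_h(p)))^{1/2}` (`opNorm_le_sum_euclidean`,
`sq_fderiv_oneForm_rep_le`). [folklore] -/
theorem norm_fderiv_coeffVec_le (x₀ : N) {z : EuclideanSpace ℝ (Fin m)}
    (hz : z ∈ (extChartAt J x₀).target) {α : Π x : N, TangentSpace J x →L[ℝ] ℝ}
    (hαs : ∀ x, ContMDiffAt J (J.prod 𝓘(ℝ, EuclideanSpace ℝ (Fin m) →L[ℝ] ℝ)) ∞ (oneFormSection α) x)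
    {Λ : ℝ} (hΛ1 : 1 ≤ Λ)
    (hΛs : ∑ i, (PseudoRiemannianMetric.ofRiemannian h).val ((extChartAt J x₀).symm z)
        ((trivializationAt (EuclideanSpace ℝ (Fin m)) (TangentSpace J) x₀).localFrame
          (EuclideanSpace.basisFun (Fin m) ℝ).toBasis i ((extChartAt J x₀).symm z))
        ((trivializationAt (EuclideanSpace ℝ (Fin m)) (TangentSpace J) x₀).localFrame
          (EuclideanSpace.basisFun (Fin m) ℝ).toBasis i ((extChartAt J x₀).symm z)) ≤ Λ)
    (hΛW : ∀ i k, (PseudoRiemannianMetric.ofRiemannian h).val ((extChartAt J x₀).symm z)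
        ((PseudoRiemannianMetric.ofRiemannian h).leviCivita
          ((trivializationAt (EuclideanSpace ℝ (Fin m)) (TangentSpace J) x₀).localFrame
            (EuclideanSpace.basisFun (Fin m) ℝ).toBasis i) ((extChartAt J x₀).symm z)
          ((trivializationAt (EuclideanSpace ℝ (Fin m)) (TangentSpace J) x₀).localFrame
            (EuclideanSpace.basisFun (Fin m) ℝ).toBasis k ((extChartAt J x₀).symm z)))
        ((PseudoRiemannianMetric.ofRiemannian h).leviCivita
          ((trivializationAt (EuclideanSpace ℝ (Fin m)) (TangentSpace J) x₀).localFrame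
            (EuclideanSpace.basisFun (Fin m) ℝ).toBasis i) ((extChartAt J x₀).symm z)
          ((trivializationAt (EuclideanSpace ℝ (Fin m)) (TangentSpace J) x₀).localFrame
            (EuclideanSpace.basisFun (Fin m) ℝ).toBasis k ((extChartAt J x₀).symm z))) ≤ Λ) :
    ‖fderiv ℝ (fun z (i : Fin m) ↦ α ((extChartAt J x₀).symm z)
        ((trivializationAt (EuclideanSpace ℝ (Fin m)) (TangentSpace J) x₀).localFrame
          (EuclideanSpace.basisFun (Fin m) ℝ).toBasis i ((extChartAt J x₀).symm z))) z‖ ≤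
      m * Real.sqrt (2 * Λ ^ 2 *
        ((PseudoRiemannianMetric.ofRiemannian h).normSq ((extChartAt J x₀).symm z)
          ((PseudoRiemannianMetric.ofRiemannian h).covDerivOneForm α ((extChartAt J x₀).symm z)) +
        (PseudoRiemannianMetric.ofRiemannian h).innerDual ((extChartAt J x₀).symm z)
          (α ((extChartAt J x₀).symm z) : TangentSpace J _ →ₗ[ℝ] ℝ) (α ((extChartAt J x₀).symm z)))) := by
  set G := PseudoRiemannianMetric.ofRiemannian h with hG
  have hg : G.IsRiemannian := PseudoRiemannianMetric.isRiemannian_ofRiemannian h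
  set e := trivializationAt (EuclideanSpace ℝ (Fin m)) (TangentSpace J) x₀ with he
  set b := (EuclideanSpace.basisFun (Fin m) ℝ).toBasis with hb
  set p := (extChartAt J x₀).symm z with hpdef
  have hp : p ∈ (chartAt H' x₀).source := by
    rw [← extChartAt_source J]; exact (extChartAt J x₀).map_target hz
  have hzp : extChartAt J x₀ p = z := (extChartAt J x₀).right_inv hz
  set Q := G.normSq p (G.covDerivOneForm α p) with hQ
  set Nα := G.innerDual p (α p : TangentSpace J p →ₗ[ℝ] ℝ) (α p) with hNα
  have hQ0 : 0 ≤ Q := G.normSq_nonneg p hg _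
  have hNα0 : 0 ≤ Nα := by
    rw [hNα, G.innerDual_eq_val_sharp_sharp]
    by_cases h0 : G.sharp p (α p : TangentSpace J p →ₗ[ℝ] ℝ) = 0
    · rw [h0]; simp
    · exact (hg p _ h0).le
  -- the coefficient vector and its components
  set V : EuclideanSpace ℝ (Fin m) → (Fin m → ℝ) := fun z i ↦ α ((extChartAt J x₀).symm z)
    (e.localFrame b i ((extChartAt J x₀).symm z)) with hV
  have hVd : DifferentiableAt ℝ V z :=
    ((contDiffOn_oneForm_coeffVec x₀ hαs).differentiableOn (by simp)).differentiableAt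
      ((isOpen_extChartAt_target x₀).mem_nhds hz)
  have hcomp : ∀ i (v : EuclideanSpace ℝ (Fin m)), fderiv ℝ V z v i =
      fderiv ℝ ((fun q ↦ α q (e.localFrame b i q)) ∘ (extChartAt J x₀).symm) z v := by
    intro i v
    have h1 := fderiv_apply hVd i
    have h2 : (fun x ↦ V x i) = (fun q ↦ α q (e.localFrame b i q)) ∘ (extChartAt J x₀).symm := by
      funext x; rfl
    rw [h2] at h1
    rw [h1]; rfl
  -- bound on single entries
  have hgdiag : ∀ i, G.val p (e.localFrame b i p) (e.localFrame b i p) ≤ Λ := fun i ↦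
    (Finset.single_le_sum (f := fun j ↦ G.val p (e.localFrame b j p) (e.localFrame b j p))
      (fun j _ ↦ by
        by_cases h0 : e.localFrame b j p = 0
        · rw [h0]; simp
        · exact (hg p _ h0).le) (Finset.mem_univ i)).trans hΛs
  have hαd : MDifferentiableAt J (J.prod 𝓘(ℝ, EuclideanSpace ℝ (Fin m) →L[ℝ] ℝ))
      (oneFormSection α) p := (hαs p).mdifferentiableAt (by simp)
  have hentry : ∀ i k, (fderiv ℝ ((fun q ↦ α q (e.localFrame b i q)) ∘ (extChartAt J x₀).symm) z
      (b k)) ^ 2 ≤ 2 * Λ ^ 2 * (Q + Nα) := by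
    intro i k
    have h1 := sq_fderiv_oneForm_rep_le G b hg hp hαd i k
    rw [hzp] at h1
    refine h1.trans ?_
    have hW := hΛW i k
    have hgi := hgdiag i
    have hgk := hgdiag k
    have hgk0 : 0 ≤ G.val p (e.localFrame b k p) (e.localFrame b k p) := by
      by_cases h0 : e.localFrame b k p = 0
      · rw [h0]; simp
      · exact (hg p _ h0).le
    have hW0 : 0 ≤ G.val p (G.leviCivita (e.localFrame b i) p (e.localFrame b k p))
        (G.leviCivita (e.localFrame b i) p (e.localFrame b k p)) := by
      by_cases h0 : G.leviCivita (e.localFrame b i) p (e.localFrame b k p) = 0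
      · rw [h0]; simp
      · exact (hg p _ h0).le
    have hΛ0 : 0 ≤ Λ := le_trans zero_le_one hΛ1
    have hprod : G.val p (e.localFrame b i p) (e.localFrame b i p) *
        G.val p (e.localFrame b k p) (e.localFrame b k p) ≤ Λ * Λ := mul_le_mul hgi hgk hgk0 hΛ0
    have hΛsq : Λ ≤ Λ ^ 2 := by nlinarith
    show 2 * (Q * G.val p (e.localFrame b i p) (e.localFrame b i p) *
        G.val p (e.localFrame b k p) (e.localFrame b k p)) +
      2 * (Nα * G.val p (G.leviCivita (e.localFrame b i) p (e.localFrame b k p))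
        (G.leviCivita (e.localFrame b i) p (e.localFrame b k p))) ≤ 2 * Λ ^ 2 * (Q + Nα)
    nlinarith [mul_le_mul_of_nonneg_left hprod hQ0, mul_le_mul_of_nonneg_left hW hNα0,
      mul_le_mul_of_nonneg_left hΛsq hNα0]
  have hbk : ∀ k, b k = EuclideanSpace.single k (1 : ℝ) := fun k ↦ by
    rw [hb, OrthonormalBasis.coe_toBasis, EuclideanSpace.basisFun_apply]
  -- assemble
  set R := Real.sqrt (2 * Λ ^ 2 * (Q + Nα)) with hR
  have hcol : ∀ k, ‖fderiv ℝ V z (EuclideanSpace.single k (1 : ℝ))‖ ≤ R := by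
    intro k
    refine (pi_norm_le_iff_of_nonneg (Real.sqrt_nonneg _)).2 fun i ↦ ?_
    rw [Real.norm_eq_abs, hcomp i, ← hbk k]
    exact Real.abs_le_sqrt (hentry i k)
  calc ‖fderiv ℝ V z‖ ≤ ∑ k, ‖fderiv ℝ V z (EuclideanSpace.single k (1 : ℝ))‖ :=
        opNorm_le_sum_euclidean _
    _ ≤ ∑ _k : Fin m, R := Finset.sum_le_sum fun k _ ↦ hcol k
    _ = m * R := by simp

end Pointwise

/-! ### The chart-local Rellich lemma for `1`-forms -/

section Rellich

open Literature.Analysis.FunctionSpaces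

variable {m : ℕ} {H' : Type*} [TopologicalSpace H']
  {J : ModelWithCorners ℝ (EuclideanSpace ℝ (Fin m)) H'} [J.Boundaryless]
  {N : Type*} [TopologicalSpace N] [ChartedSpace H' N] [IsManifold J ∞ N]
  [T3Space N] [MeasurableSpace N] [BorelSpace N]
  (h : ContMDiffRiemannianMetric J ∞ (EuclideanSpace ℝ (Fin m)) (TangentSpace J : N → Type _))
  [(PseudoRiemannianMetric.ofRiemannian h).HasLeviCivita]

/-- `eLpNorm f 2 = (∫ ‖f‖ₑ²)^{1/2}`. [folklore] -/
theorem eLpNorm_two_eq_rpow {X F : Type*} [MeasurableSpace X] [NormedAddCommGroup F]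
    (μ : Measure X) (f : X → F) :
    eLpNorm f 2 μ = (∫⁻ x, ‖f x‖ₑ ^ (2 : ℝ) ∂μ) ^ (1 / 2 : ℝ) := by
  rw [eLpNorm_eq_lintegral_rpow_enorm_toReal two_ne_zero ENNReal.ofNat_ne_top]
  norm_num

set_option maxHeartbeats 800000 in
/-- **The chart-local Rellich lemma for `1`-forms.** Let `φ` be the extended chart at `x₀`,
`B̄(φ x₀, 2r) ⊆ φ.target`, and let `αₙ` be smooth `1`-forms with
`∫_{φ.source ∩ φ⁻¹ B̄(φ x₀, 2r)} (|αₙ|²_h + |∇αₙ|²_h) dV_h ≤ A` for all `n`. Then there is a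
subsequence `α_{ψ n}` which is Cauchy in `L²` of the half ball (the pointwise norms
`|∇αₙ|²_h` are assumed continuous — e.g. for closed forms, `contMDiffAt_normSq_covDerivOneForm`):
`∫_{φ.source ∩ φ⁻¹ B(φ x₀, r)} |α_{ψ a} - α_{ψ b}|²_h dV_h → 0` as `a, b → ∞`. Proof: the
coefficient vectors `uₙ = ψ · (α̂ₙ,₁, …, α̂ₙ,ₘ)` (`ψ` a bump equal to `1` on `B̄(φ x₀, r)` and
supported in `B̄(φ x₀, 2r)`) are `C¹`, supported in a fixed compact set, and bounded in `W^{1,2}`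
for Lebesgue measure by the pointwise comparisons of `OneFormChartBounds.lean` and the pinching
of the Riemannian density; the tree's `C¹` Rellich core
(`exists_subseq_tendsto_eLpNorm_of_contDiff`, Evans §5.7 Thm. 1) extracts an `L²`-convergent
subsequence, and `|α|²_h ≤ m² Λ ‖û‖²` transfers the Cauchy property back to the manifold.
[cite: Evans2010, §5.7 Theorem 1] -/
theorem exists_subseq_cauchy_oneForm_chart (x₀ : N) {r : ℝ} (hr : 0 < r)
    (h2r : closedBall (extChartAt J x₀ x₀) (2 * r) ⊆ (extChartAt J x₀).target)
    (α : ℕ → Π x : N, TangentSpace J x →L[ℝ] ℝ)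
    (hα : ∀ n x, ContMDiffAt J (J.prod 𝓘(ℝ, EuclideanSpace ℝ (Fin m) →L[ℝ] ℝ)) ∞
      (oneFormSection (α n)) x)
    (hQc : ∀ n, Continuous fun y ↦ (PseudoRiemannianMetric.ofRiemannian h).normSq y
      ((PseudoRiemannianMetric.ofRiemannian h).covDerivOneForm (α n) y))
    {A : ℝ} (hA : ∀ n, ∫⁻ y in (extChartAt J x₀).source ∩
        extChartAt J x₀ ⁻¹' closedBall (extChartAt J x₀ x₀) (2 * r),
      ENNReal.ofReal ((PseudoRiemannianMetric.ofRiemannian h).innerDual y (α n y).toLinearMap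
          (α n y).toLinearMap + (PseudoRiemannianMetric.ofRiemannian h).normSq y
          ((PseudoRiemannianMetric.ofRiemannian h).covDerivOneForm (α n) y)) ∂riemannianMeasure h ≤
        ENNReal.ofReal A) :
    ∃ ψ : ℕ → ℕ, StrictMono ψ ∧ ∀ ε : ℝ, 0 < ε → ∃ N₀ : ℕ, ∀ a b, N₀ ≤ a → N₀ ≤ b →
      ∫⁻ y in (extChartAt J x₀).source ∩ extChartAt J x₀ ⁻¹' ball (extChartAt J x₀ x₀) r,
        ENNReal.ofReal ((PseudoRiemannianMetric.ofRiemannian h).innerDual y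
          ((α (ψ a) - α (ψ b)) y).toLinearMap ((α (ψ a) - α (ψ b)) y).toLinearMap)
          ∂riemannianMeasure h < ENNReal.ofReal ε := by
  classical
  haveI : IsManifold J 1 N := IsManifold.of_le (n := ∞) (by exact_mod_cast le_top)
  set G := PseudoRiemannianMetric.ofRiemannian h with hG
  have hg : G.IsRiemannian := PseudoRiemannianMetric.isRiemannian_ofRiemannian h
  set φ := extChartAt J x₀ with hφ
  set c : EuclideanSpace ℝ (Fin m) := φ x₀ with hc
  set e := trivializationAt (EuclideanSpace ℝ (Fin m)) (TangentSpace J) x₀ with he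
  set b := (EuclideanSpace.basisFun (Fin m) ℝ).toBasis with hb
  set ν := riemannianMeasure h with hν
  -- Step 0: the compact pieces and the uniform constants
  set K₂ : Set (EuclideanSpace ℝ (Fin m)) := closedBall c (2 * r) with hK₂
  have hK₂c : IsCompact K₂ := isCompact_closedBall _ _
  have hK₂m : MeasurableSet K₂ := isClosed_closedBall.measurableSet
  have hball : ball c r ⊆ K₂ := ball_subset_closedBall.trans (closedBall_subset_closedBall (by linarith))
  have hballt : ball c r ⊆ φ.target := hball.trans h2r
  set C : Set N := φ.symm '' K₂ with hCdef
  have hCc : IsCompact C := hK₂c.image_of_continuousOn ((continuousOn_extChartAt_symm x₀).mono h2r)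
  have hCs : C ⊆ (chartAt H' x₀).source := by
    rintro _ ⟨z, hz, rfl⟩
    rw [← extChartAt_source J]
    exact φ.map_target (h2r hz)
  obtain ⟨Λ₀, hΛ₀0, hΛs₀, hΛinv₀, hΛW₀⟩ := exists_chart_data_bound G b hCc hCs
  set Λ : ℝ := max Λ₀ 1 with hΛ
  have hΛ1 : 1 ≤ Λ := le_max_right _ _
  have hΛ0 : 0 ≤ Λ := le_trans zero_le_one hΛ1
  have hmemC : ∀ z ∈ K₂, φ.symm z ∈ C := fun z hz ↦ mem_image_of_mem _ hz
  have hΛs : ∀ z ∈ K₂, ∑ i, G.val (φ.symm z) (e.localFrame b i (φ.symm z))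
      (e.localFrame b i (φ.symm z)) ≤ Λ := fun z hz ↦ (hΛs₀ _ (hmemC z hz)).trans (le_max_left _ _)
  have hΛinv : ∀ z ∈ K₂, ∀ k l, |(Matrix.of fun i j ↦ G.val (φ.symm z)
      (e.localFrame b i (φ.symm z)) (e.localFrame b j (φ.symm z)))⁻¹ k l| ≤ Λ :=
    fun z hz k l ↦ (hΛinv₀ _ (hmemC z hz) k l).trans (le_max_left _ _)
  have hΛW : ∀ z ∈ K₂, ∀ i k, G.val (φ.symm z)
      (G.leviCivita (e.localFrame b i) (φ.symm z) (e.localFrame b k (φ.symm z)))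
      (G.leviCivita (e.localFrame b i) (φ.symm z) (e.localFrame b k (φ.symm z))) ≤ Λ :=
    fun z hz i k ↦ (hΛW₀ _ (hmemC z hz) i k).trans (le_max_left _ _)
  obtain ⟨δ, Δ, hδ, hδΔ, hρ⟩ := exists_density_bounds h x₀ hK₂c h2r
  have hΔ0 : 0 ≤ Δ := hδ.le.trans hδΔ
  -- the bump function
  let ψb : ContDiffBump c := ⟨r, 2 * r, hr, by linarith⟩
  have hψs : ContDiff ℝ ∞ ψb := ψb.contDiff
  have hψ1 : ∀ z ∈ closedBall c r, ψb z = 1 := fun z hz ↦ ψb.one_of_mem_closedBall hz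
  have hψt : tsupport ψb = K₂ := ψb.tsupport_eq
  have hψ01 : ∀ z, 0 ≤ ψb z ∧ ψb z ≤ 1 := fun z ↦ ⟨ψb.nonneg, ψb.le_one⟩
  obtain ⟨Cψ, hCψ⟩ : ∃ Cψ, ∀ z, ‖fderiv ℝ ψb z‖ ≤ Cψ :=
    (hψs.continuous_fderiv (by simp)).bounded_above_of_compact_support
      (ψb.hasCompactSupport.fderiv (𝕜 := ℝ))
  have hCψ0 : 0 ≤ Cψ := (norm_nonneg _).trans (hCψ c)
  -- Step 1: the coefficient vectors and the cut-off functions `u n`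
  set V : ℕ → EuclideanSpace ℝ (Fin m) → (Fin m → ℝ) := fun n z i ↦ α n (φ.symm z)
    (e.localFrame b i (φ.symm z)) with hV
  have hVs : ∀ n, ContDiffOn ℝ ∞ (V n) φ.target := fun n ↦ contDiffOn_oneForm_coeffVec x₀ (hα n)
  set u : ℕ → EuclideanSpace ℝ (Fin m) → (Fin m → ℝ) := fun n z ↦ ψb z • V n z with hu
  have hus : ∀ n, ContDiff ℝ 1 (u n) := fun n ↦
    contDiff_smul_of_tsupport_subset (isOpen_extChartAt_target x₀) ((hVs n).of_le (by exact_mod_cast le_top))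
      (hψs.of_le (by exact_mod_cast le_top)) (hψt ▸ h2r)
  have husupp : ∀ n, tsupport (u n) ⊆ K₂ := fun n ↦ by
    rw [← hψt]; exact tsupport_smul_subset_left _ _
  have hu0 : ∀ n, ∀ z ∉ K₂, u n z = 0 := fun n z hz ↦
    image_eq_zero_of_notMem_tsupport fun h' ↦ hz (husupp n h')
  -- Step 2: pointwise bounds on `K₂`
  set Nα : ℕ → N → ℝ := fun n y ↦ G.innerDual y (α n y).toLinearMap (α n y).toLinearMap with hNα
  set Q : ℕ → N → ℝ := fun n y ↦ G.normSq y (G.covDerivOneForm (α n) y) with hQ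
  have hNα0 : ∀ n y, 0 ≤ Nα n y := fun n y ↦ innerDual_self_nonneg (h := h) y _
  have hQ0 : ∀ n y, 0 ≤ Q n y := fun n y ↦ G.normSq_nonneg y hg _
  have hVbound : ∀ n, ∀ z ∈ K₂, ‖V n z‖ ^ 2 ≤ Λ * Nα n (φ.symm z) := by
    intro n z hz
    have := norm_coeffVec_sq_le h x₀ (φ.symm z) (α n (φ.symm z)).toLinearMap
    exact this.trans (mul_le_mul_of_nonneg_right (hΛs z hz) (hNα0 n _))
  have hDVbound : ∀ n, ∀ z ∈ K₂, ‖fderiv ℝ (V n) z‖ ≤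
      m * Real.sqrt (2 * Λ ^ 2 * (Q n (φ.symm z) + Nα n (φ.symm z))) := fun n z hz ↦
    norm_fderiv_coeffVec_le h x₀ (h2r hz) (hα n) hΛ1 (hΛs z hz) (hΛW z hz)
  set Cd : ℝ := 2 * ((m : ℝ) ^ 2 * (2 * Λ ^ 2)) + 2 * (Cψ ^ 2 * Λ) with hCd
  have hCd0 : 0 ≤ Cd := by positivity
  have hubound : ∀ n z, ‖u n z‖ ^ 2 ≤ Λ * K₂.indicator (fun z ↦ Nα n (φ.symm z)) z := by
    intro n z
    by_cases hz : z ∈ K₂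
    · rw [indicator_of_mem hz]
      have h1 : ‖u n z‖ ≤ ‖V n z‖ := by
        simp only [hu, norm_smul, Real.norm_eq_abs, abs_of_nonneg (hψ01 z).1]
        exact mul_le_of_le_one_left (norm_nonneg _) (hψ01 z).2
      exact (pow_le_pow_left₀ (norm_nonneg _) h1 2).trans (hVbound n z hz)
    · rw [hu0 n z hz, indicator_of_notMem hz]; simp
  have hDubound : ∀ n z, ‖fderiv ℝ (u n) z‖ ^ 2 ≤
      Cd * K₂.indicator (fun z ↦ Q n (φ.symm z) + Nα n (φ.symm z)) z := by
    intro n z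
    by_cases hz : z ∈ K₂
    · rw [indicator_of_mem hz]
      have hzt : z ∈ φ.target := h2r hz
      have hVd : DifferentiableAt ℝ (V n) z :=
        ((hVs n).differentiableOn (by simp)).differentiableAt ((isOpen_extChartAt_target x₀).mem_nhds hzt)
      have hψd : DifferentiableAt ℝ ψb z := (hψs.differentiable (by simp)) z
      have hprod : fderiv ℝ (u n) z = ψb z • fderiv ℝ (V n) z + (fderiv ℝ ψb z).smulRight (V n z) :=
        fderiv_fun_smul hψd hVd
      have h1 : ‖fderiv ℝ (u n) z‖ ≤ ‖fderiv ℝ (V n) z‖ + Cψ * ‖V n z‖ := by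
        rw [hprod]
        refine (norm_add_le _ _).trans (add_le_add ?_ ?_)
        · rw [norm_smul, Real.norm_eq_abs, abs_of_nonneg (hψ01 z).1]
          exact mul_le_of_le_one_left (norm_nonneg _) (hψ01 z).2
        · rw [ContinuousLinearMap.norm_smulRight_apply]
          exact mul_le_mul_of_nonneg_right (hCψ z) (norm_nonneg _)
      have h2 := hDVbound n z hz
      have h3 := hVbound n z hz
      set QN := Q n (φ.symm z) + Nα n (φ.symm z) with hQN
      have hQN0 : 0 ≤ QN := add_nonneg (hQ0 n _) (hNα0 n _)
      have h4 : ‖fderiv ℝ (V n) z‖ ^ 2 ≤ (m : ℝ) ^ 2 * (2 * Λ ^ 2 * QN) := by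
        calc ‖fderiv ℝ (V n) z‖ ^ 2 ≤ (m * Real.sqrt (2 * Λ ^ 2 * QN)) ^ 2 :=
              pow_le_pow_left₀ (norm_nonneg _) h2 2
          _ = (m : ℝ) ^ 2 * (2 * Λ ^ 2 * QN) := by
              rw [mul_pow, Real.sq_sqrt (by positivity)]
      have h5 : ‖V n z‖ ^ 2 ≤ Λ * QN :=
        h3.trans (mul_le_mul_of_nonneg_left (le_add_of_nonneg_left (hQ0 n _)) hΛ0)
      calc ‖fderiv ℝ (u n) z‖ ^ 2 ≤ (‖fderiv ℝ (V n) z‖ + Cψ * ‖V n z‖) ^ 2 :=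
            pow_le_pow_left₀ (norm_nonneg _) h1 2
        _ ≤ 2 * ‖fderiv ℝ (V n) z‖ ^ 2 + 2 * (Cψ * ‖V n z‖) ^ 2 := by
            nlinarith [sq_nonneg (‖fderiv ℝ (V n) z‖ - Cψ * ‖V n z‖)]
        _ ≤ 2 * ((m : ℝ) ^ 2 * (2 * Λ ^ 2 * QN)) + 2 * (Cψ ^ 2 * (Λ * QN)) := by
            rw [mul_pow]
            gcongr
        _ = Cd * QN := by rw [hCd]; ring
    · have hev : u n =ᶠ[𝓝 z] fun _ ↦ 0 := by
        filter_upwards [hK₂c.isClosed.isOpen_compl.mem_nhds hz] with y hy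
        exact hu0 n y hy
      rw [hev.fderiv_eq, fderiv_const_apply, indicator_of_notMem hz]
      simp
  -- Step 3: the integral bounds in the chart
  have hNc : ∀ n, Continuous (Nα n) := fun n ↦
    (ContMDiff.continuous fun y ↦ contMDiffAt_innerDual_oneForm G (hα n y) (hα n y))
  have hQc' : ∀ n, Continuous (Q n) := hQc
  have hFm : ∀ n, Measurable fun y ↦ ENNReal.ofReal (Nα n y + Q n y) := fun n ↦
    ((hNc n).add (hQc' n)).measurable.ennreal_ofReal
  set Abnd : ℝ≥0∞ := ENNReal.ofReal A / ENNReal.ofReal δ with hAbnd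
  have hAbndT : Abnd ≠ ⊤ := (ENNReal.div_lt_top ENNReal.ofReal_ne_top (ENNReal.ofReal_pos.2 hδ).ne').ne
  have hIK : ∀ n, ∫⁻ z in K₂, ENNReal.ofReal (Nα n (φ.symm z) + Q n (φ.symm z)) ≤ Abnd := by
    intro n
    have h1 := mul_setLIntegral_chart_le h x₀ hK₂m h2r (fun z hz ↦ (hρ z hz).1) (hFm n)
    have h2 := h1.trans (hA n)
    rw [hAbnd, ENNReal.le_div_iff_mul_le (Or.inl (ENNReal.ofReal_pos.2 hδ).ne')
      (Or.inl ENNReal.ofReal_ne_top), mul_comm]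
    exact h2
  have henorm : ∀ (w : Fin m → ℝ), (‖w‖ₑ : ℝ≥0∞) ^ (2 : ℝ) = ENNReal.ofReal (‖w‖ ^ 2) := fun w ↦ by
    rw [← ofReal_norm, ENNReal.ofReal_rpow_of_nonneg (norm_nonneg _) (by norm_num),
      Real.rpow_two]
  have henormL : ∀ (L : EuclideanSpace ℝ (Fin m) →L[ℝ] (Fin m → ℝ)),
      (‖L‖ₑ : ℝ≥0∞) ^ (2 : ℝ) = ENNReal.ofReal (‖L‖ ^ 2) := fun L ↦ by
    rw [← ofReal_norm, ENNReal.ofReal_rpow_of_nonneg (norm_nonneg _) (by norm_num),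
      Real.rpow_two]
  have hIu : ∀ n, ∫⁻ z, (‖u n z‖ₑ : ℝ≥0∞) ^ (2 : ℝ) ≤ ENNReal.ofReal Λ * Abnd := by
    intro n
    calc ∫⁻ z, (‖u n z‖ₑ : ℝ≥0∞) ^ (2 : ℝ)
        ≤ ∫⁻ z, K₂.indicator (fun z ↦ ENNReal.ofReal (Λ * (Nα n (φ.symm z) + Q n (φ.symm z)))) z := by
          refine lintegral_mono fun z ↦ ?_
          rw [henorm]
          by_cases hz : z ∈ K₂
          · rw [indicator_of_mem hz]
            refine ENNReal.ofReal_le_ofReal ((hubound n z).trans ?_)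
            rw [indicator_of_mem hz]
            exact mul_le_mul_of_nonneg_left (le_add_of_nonneg_right (hQ0 n _)) hΛ0
          · rw [indicator_of_notMem hz, hu0 n z hz]; simp
      _ = ∫⁻ z in K₂, ENNReal.ofReal Λ * ENNReal.ofReal (Nα n (φ.symm z) + Q n (φ.symm z)) := by
          rw [lintegral_indicator hK₂m]
          refine lintegral_congr fun z ↦ ENNReal.ofReal_mul hΛ0
      _ = ENNReal.ofReal Λ * ∫⁻ z in K₂, ENNReal.ofReal (Nα n (φ.symm z) + Q n (φ.symm z)) :=
          lintegral_const_mul' _ _ ENNReal.ofReal_ne_top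
      _ ≤ ENNReal.ofReal Λ * Abnd := mul_le_mul' le_rfl (hIK n)
  have hIDu : ∀ n, ∫⁻ z, (‖fderiv ℝ (u n) z‖ₑ : ℝ≥0∞) ^ (2 : ℝ) ≤ ENNReal.ofReal Cd * Abnd := by
    intro n
    calc ∫⁻ z, (‖fderiv ℝ (u n) z‖ₑ : ℝ≥0∞) ^ (2 : ℝ)
        ≤ ∫⁻ z, K₂.indicator (fun z ↦ ENNReal.ofReal (Cd * (Nα n (φ.symm z) + Q n (φ.symm z)))) z := by
          refine lintegral_mono fun z ↦ ?_
          rw [henormL]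
          by_cases hz : z ∈ K₂
          · rw [indicator_of_mem hz]
            refine ENNReal.ofReal_le_ofReal ((hDubound n z).trans (le_of_eq ?_))
            rw [indicator_of_mem hz, add_comm]
          · rw [indicator_of_notMem hz]
            have := hDubound n z
            rw [indicator_of_notMem hz, mul_zero] at this
            have h0 : ‖fderiv ℝ (u n) z‖ ^ 2 = 0 := le_antisymm this (sq_nonneg _)
            simp [h0]
      _ = ∫⁻ z in K₂, ENNReal.ofReal Cd * ENNReal.ofReal (Nα n (φ.symm z) + Q n (φ.symm z)) := by
          rw [lintegral_indicator hK₂m]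
          refine lintegral_congr fun z ↦ ENNReal.ofReal_mul hCd0
      _ = ENNReal.ofReal Cd * ∫⁻ z in K₂, ENNReal.ofReal (Nα n (φ.symm z) + Q n (φ.symm z)) :=
          lintegral_const_mul' _ _ ENNReal.ofReal_ne_top
      _ ≤ ENNReal.ofReal Cd * Abnd := mul_le_mul' le_rfl (hIK n)
  set Abound : ℝ≥0∞ := (ENNReal.ofReal Λ * Abnd) ^ (1 / 2 : ℝ) with hAbound
  set Bbound : ℝ≥0∞ := (ENNReal.ofReal Cd * Abnd) ^ (1 / 2 : ℝ) with hBbound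
  have hAt : Abound ≠ ⊤ :=
    ENNReal.rpow_ne_top_of_nonneg (by norm_num) (ENNReal.mul_ne_top ENNReal.ofReal_ne_top hAbndT)
  have hBt : Bbound ≠ ⊤ :=
    ENNReal.rpow_ne_top_of_nonneg (by norm_num) (ENNReal.mul_ne_top ENNReal.ofReal_ne_top hAbndT)
  have huA : ∀ n, eLpNorm (u n) 2 volume ≤ Abound := fun n ↦ by
    rw [eLpNorm_two_eq_rpow]
    exact ENNReal.rpow_le_rpow (hIu n) (by norm_num)
  have huB : ∀ n, eLpNorm (fderiv ℝ (u n)) 2 volume ≤ Bbound := fun n ↦ by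
    rw [eLpNorm_two_eq_rpow]
    exact ENNReal.rpow_le_rpow (hIDu n) (by norm_num)
  -- Step 4: the `C¹` Rellich core
  obtain ⟨f, ψ, hψm, hfmem, hlim⟩ := exists_subseq_tendsto_eLpNorm_of_contDiff
    (volume : Measure (EuclideanSpace ℝ (Fin m))) (p := 2) (by norm_num) hK₂c u hus husupp hAt hBt
    huA huB
  refine ⟨ψ, hψm, fun ε hε ↦ ?_⟩
  -- Step 5: choose the `L²` accuracy `η`
  obtain ⟨κ, hκ, hκ0⟩ : ∃ κ : ℝ, κ = Δ * ((m : ℝ) ^ 2 * Λ) ∧ 0 ≤ κ := ⟨_, rfl, by positivity⟩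
  obtain ⟨η, hη0, hηsq⟩ : ∃ η : ℝ, 0 < η ∧ η ^ 2 = ε / (2 * (κ + 1)) :=
    ⟨Real.sqrt (ε / (2 * (κ + 1))), Real.sqrt_pos.2 (by positivity), Real.sq_sqrt (by positivity)⟩
  have hκη : κ * η ^ 2 ≤ ε / 2 := by
    rw [hηsq, mul_div_assoc', div_le_iff₀ (by positivity : (0 : ℝ) < 2 * (κ + 1))]
    have : ε / 2 * (2 * (κ + 1)) = κ * ε + ε := by ring
    rw [this]
    linarith
  obtain ⟨N₀, hN₀⟩ : ∃ N₀, ∀ a, N₀ ≤ a →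
      eLpNorm (u (ψ a) - f) 2 volume < ENNReal.ofReal (η / 2) := by
    have hpos : (0 : ℝ≥0∞) < ENNReal.ofReal (η / 2) := ENNReal.ofReal_pos.2 (half_pos hη0)
    exact eventually_atTop.1 ((tendsto_order.1 hlim).2 _ hpos)
  refine ⟨N₀, fun a b' ha hb' ↦ ?_⟩
  have humeas : ∀ n, AEStronglyMeasurable (u n) volume := fun n ↦
    (hus n).continuous.aestronglyMeasurable
  have hfmeas : AEStronglyMeasurable f volume := hfmem.aestronglyMeasurable
  have hCauchy : eLpNorm (u (ψ a) - u (ψ b')) 2 volume < ENNReal.ofReal η := by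
    have heq : u (ψ a) - u (ψ b') = (u (ψ a) - f) - (u (ψ b') - f) := by abel
    rw [heq]
    calc eLpNorm ((u (ψ a) - f) - (u (ψ b') - f)) 2 volume
        ≤ eLpNorm (u (ψ a) - f) 2 volume + eLpNorm (u (ψ b') - f) 2 volume :=
          eLpNorm_sub_le ((humeas _).sub hfmeas) ((humeas _).sub hfmeas) (by norm_num)
      _ < ENNReal.ofReal (η / 2) + ENNReal.ofReal (η / 2) := ENNReal.add_lt_add (hN₀ a ha) (hN₀ b' hb')
      _ = ENNReal.ofReal η := by
          rw [← ENNReal.ofReal_add (half_pos hη0).le (half_pos hη0).le]; congr 1; ring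
  -- Step 6: back to the manifold on the half ball
  set β : Π x : N, TangentSpace J x →L[ℝ] ℝ := α (ψ a) - α (ψ b') with hβ
  have hβs : ∀ x, ContMDiffAt J (J.prod 𝓘(ℝ, EuclideanSpace ℝ (Fin m) →L[ℝ] ℝ)) ∞
      (oneFormSection β) x := fun x ↦ (hα (ψ a) x).sub_section (hα (ψ b') x)
  set Nβ : N → ℝ := fun y ↦ G.innerDual y (β y).toLinearMap (β y).toLinearMap with hNβ
  have hNβc : Continuous Nβ :=
    ContMDiff.continuous fun y ↦ contMDiffAt_innerDual_oneForm G (hβs y) (hβs y)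
  have hNβm : Measurable fun y ↦ ENNReal.ofReal (Nβ y) := hNβc.measurable.ennreal_ofReal
  have hballm : MeasurableSet (ball c r) := isOpen_ball.measurableSet
  -- pointwise: `|β|² ≤ m² Λ ‖u_a - u_b‖²` on the half ball
  have hpt : ∀ z ∈ ball c r, ENNReal.ofReal (Nβ (φ.symm z)) ≤
      ENNReal.ofReal ((m : ℝ) ^ 2 * Λ) * (‖(u (ψ a) - u (ψ b')) z‖ₑ : ℝ≥0∞) ^ (2 : ℝ) := by
    intro z hz
    have hzK : z ∈ K₂ := hball hz
    have hzt : z ∈ φ.target := h2r hzK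
    set p := φ.symm z with hp
    have hps : p ∈ (chartAt H' x₀).source := by
      rw [← extChartAt_source J]; exact φ.map_target hzt
    have h1 := innerDual_le_mul_sum_sq G b hps (β p).toLinearMap (hΛinv z hzK)
    have hψz : ψb z = 1 := hψ1 z (mem_closedBall.2 (le_of_lt (mem_ball.1 hz)))
    have hcoord : ∀ i, (β p).toLinearMap (e.localFrame b i p) = (u (ψ a) - u (ψ b')) z i := by
      intro i
      simp only [hβ, hu, hV, Pi.sub_apply, FunLike.coe_sub, ContinuousLinearMap.coe_coe,
        hψz, one_smul]
      rfl
    have h2 : ∑ i, ((β p).toLinearMap (e.localFrame b i p)) ^ 2 ≤ m * ‖(u (ψ a) - u (ψ b')) z‖ ^ 2 := by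
      calc ∑ i, ((β p).toLinearMap (e.localFrame b i p)) ^ 2
          ≤ ∑ _i : Fin m, ‖(u (ψ a) - u (ψ b')) z‖ ^ 2 := by
            refine Finset.sum_le_sum fun i _ ↦ ?_
            rw [hcoord i, ← sq_abs, ← Real.norm_eq_abs]
            exact pow_le_pow_left₀ (norm_nonneg _) (norm_le_pi_norm _ i) 2
        _ = m * ‖(u (ψ a) - u (ψ b')) z‖ ^ 2 := by simp
    rw [henorm, ← ENNReal.ofReal_mul (by positivity)]
    refine ENNReal.ofReal_le_ofReal ?_
    calc Nβ p ≤ (Fintype.card (Fin m)) * Λ * ∑ i, ((β p).toLinearMap (e.localFrame b i p)) ^ 2 := h1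
      _ ≤ (m : ℝ) * Λ * (m * ‖(u (ψ a) - u (ψ b')) z‖ ^ 2) := by
          rw [Fintype.card_fin]
          exact mul_le_mul_of_nonneg_left h2 (by positivity)
      _ = (m : ℝ) ^ 2 * Λ * ‖(u (ψ a) - u (ψ b')) z‖ ^ 2 := by ring
  have hsq : ∫⁻ z, (‖(u (ψ a) - u (ψ b')) z‖ₑ : ℝ≥0∞) ^ (2 : ℝ) =
      eLpNorm (u (ψ a) - u (ψ b')) 2 volume ^ (2 : ℝ) := by
    rw [eLpNorm_two_eq_rpow, ← ENNReal.rpow_mul]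
    norm_num
  calc ∫⁻ y in φ.source ∩ φ ⁻¹' ball c r, ENNReal.ofReal (Nβ y) ∂ν
      ≤ ENNReal.ofReal Δ * ∫⁻ z in ball c r, ENNReal.ofReal (Nβ (φ.symm z)) :=
        setLIntegral_chart_piece_le_mul h x₀ hballm hballt (fun z hz ↦ (hρ z (hball hz)).2) hNβm
    _ ≤ ENNReal.ofReal Δ * ∫⁻ z in ball c r, ENNReal.ofReal ((m : ℝ) ^ 2 * Λ) *
          (‖(u (ψ a) - u (ψ b')) z‖ₑ : ℝ≥0∞) ^ (2 : ℝ) :=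
        mul_le_mul' le_rfl (setLIntegral_mono' hballm hpt)
    _ ≤ ENNReal.ofReal Δ * (ENNReal.ofReal ((m : ℝ) ^ 2 * Λ) *
          ∫⁻ z, (‖(u (ψ a) - u (ψ b')) z‖ₑ : ℝ≥0∞) ^ (2 : ℝ)) := by
        refine mul_le_mul' le_rfl ?_
        rw [← lintegral_const_mul' _ _ ENNReal.ofReal_ne_top]
        exact lintegral_mono' Measure.restrict_le_self le_rfl
    _ = ENNReal.ofReal κ * eLpNorm (u (ψ a) - u (ψ b')) 2 volume ^ (2 : ℝ) := by
        rw [hsq, ← mul_assoc, ← ENNReal.ofReal_mul hΔ0, hκ]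
    _ ≤ ENNReal.ofReal κ * ENNReal.ofReal η ^ (2 : ℝ) := by
        refine mul_le_mul' le_rfl (ENNReal.rpow_le_rpow hCauchy.le (by norm_num))
    _ = ENNReal.ofReal (κ * η ^ 2) := by
        rw [ENNReal.ofReal_rpow_of_nonneg hη0.le (by norm_num), Real.rpow_two, ← ENNReal.ofReal_mul hκ0]
    _ < ENNReal.ofReal ε := by
        rw [ENNReal.ofReal_lt_ofReal_iff hε]
        linarith

end Rellich

end Literature.Geometry.Riemannian

end
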